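import Literature.MathematicalPhysics.QuantumLattice.FermionCondFreeEnergyCertificateEnclosure
import Literature.Computability.AlgebraicComplexity.FixedPointExp
import HarnessLib

/-!
# Kernel-evaluable checks of the SCALAR side conditions of the thermal certificate rows

Topic `MathematicalPhysics/QuantumLattice`. The row families of the thermal certificate reader
(`HubbardTTPrimeThermalWindowCertificateSymm.lean` and the entropy rows) carry scalar hypotheses on rational
sidecar data, all of the form «a rational is above / below the exponential of a rational»:

* `eeb-lin` rows: `e^{s−1} ≤ q` (the tangent minorant of `x log(x/y)`; the reader's `hq`);
* `ent` rows: `Σ_k e^{−u_k} ≤ 1` ⇒ `log Re Tr e^{−G} ≤ 0` (`log_re_partitionFn_one_nonpos_of_enclosures`);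
* `cent-lb` certificates from enclosures: `e^{−g_k} ≤ e⁺_k`, `e_l ≤ e^{−u_k}`, `c_l ≤ e^c`
  (`fermion_condFreeEnergy_certificate_of_enclosures`).

With the reflective fixed-point exponential of `Literature/Computability/AlgebraicComplexity/FixedPointExp.lean`
(`FixedPoint.expLo/expHi`, soundness `exp_sound_of_hintOk`; first-order `ℕ`/`ℤ` code) these become Boolean
checks decidable by `decide +kernel`, each with a soundness theorem stating the real inequality:

* `expLeCheck P N s xn xd yn yd` ⇒ `exp(xn/xd) ≤ yn/yd` (`expLeCheck_sound`);
* `leExpCheck P N s yn yd xn xd` ⇒ `yn/yd ≤ exp(xn/xd)` (`leExpCheck_sound`);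
* `eebScalarCheck P N s sn sd qn qd` ⇒ `exp(sn/sd − 1) ≤ qn/qd` (`eebScalarCheck_sound`);
* `entSumCheck P N s us ud` ⇒ `Σ_k exp(−us_k/ud) ≤ 1` for a list of numerators over a common denominator
  (`entSumCheck_sound`), and the ent constant `log Re Tr e^{−G} ≤ 0` for an exactly diagonalised witness
  whose spectrum is that list (`log_re_partitionFn_one_nonpos_of_entSumCheck`).

So a kernel row file can discharge every scalar hypothesis of a thermal row by `decide +kernel`, leaving as the
claim node's content only the finite-dimensional linear algebra (dual identity, PSD Gram blocks, LDLᵀ facts).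
Everything is PROVED; the definitions are Boolean checkers (first-order arithmetic).

References: Muller, *Elementary Functions* (2016) Ch. 4 (fixed-point exp) [folklore via FixedPointExp];
Fawzi–Fawzi–Scalet 2024 Thm. 3.6 (the rows) [FawziFawziScalet2024]; Israel 1979 Lemma II.3.1 [Israel1979].
-/

noncomputable section

namespace Literature.MathematicalPhysics.QuantumLattice

open Matrix Finset
open Literature.Computability.AlgebraicComplexity
open Literature.Computability.AlgebraicComplexity.FixedPoint
open scoped BigOperators

/-! ### §1 One exponential against one rational -/

/-- **Check `exp(xn/xd) ≤ yn/yd`**: hint check + `expHi(x)·yd ≤ yn·2^P` in integers. [cite: Israel1979, Lemma II.3.1] -/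
def expLeCheck (P N s : ℕ) (xn : ℤ) (xd : ℕ) (yn : ℤ) (yd : ℕ) : Bool :=
  expHintOk N s xn xd && decide (0 < yd) && decide (((expHi P N s xn xd : ℕ) : ℤ) * yd ≤ yn * 2 ^ P)

/-- Soundness of `expLeCheck`: `exp(xn/xd) ≤ yn/yd`. [cite: Israel1979, Lemma II.3.1] -/
theorem expLeCheck_sound {P N s : ℕ} {xn : ℤ} {xd : ℕ} {yn : ℤ} {yd : ℕ}
    (h : expLeCheck P N s xn xd yn yd = true) :
    Real.exp ((xn : ℝ) / xd) ≤ (yn : ℝ) / yd := by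
  simp only [expLeCheck, Bool.and_eq_true, decide_eq_true_eq] at h
  obtain ⟨⟨hhint, hyd⟩, hle⟩ := h
  have hs := (exp_sound_of_hintOk P hhint).2
  have hP : (0 : ℝ) < (2 : ℝ) ^ P := by positivity
  have hydR : (0 : ℝ) < (yd : ℝ) := by exact_mod_cast hyd
  have hleR : ((expHi P N s xn xd : ℕ) : ℝ) * (yd : ℝ) ≤ (yn : ℝ) * (2 : ℝ) ^ P := by exact_mod_cast hle
  rw [le_div_iff₀ hydR]
  nlinarith

/-- **Check `yn/yd ≤ exp(xn/xd)`**: hint check + `yn·2^P ≤ expLo(x)·yd` in integers. [cite: Israel1979, Lemma II.3.1] -/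
def leExpCheck (P N s : ℕ) (yn : ℤ) (yd : ℕ) (xn : ℤ) (xd : ℕ) : Bool :=
  expHintOk N s xn xd && decide (0 < yd) && decide (yn * 2 ^ P ≤ ((expLo P N s xn xd : ℕ) : ℤ) * yd)

/-- Soundness of `leExpCheck`: `yn/yd ≤ exp(xn/xd)`. [cite: Israel1979, Lemma II.3.1] -/
theorem leExpCheck_sound {P N s : ℕ} {yn : ℤ} {yd : ℕ} {xn : ℤ} {xd : ℕ}
    (h : leExpCheck P N s yn yd xn xd = true) :
    (yn : ℝ) / yd ≤ Real.exp ((xn : ℝ) / xd) := by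
  simp only [leExpCheck, Bool.and_eq_true, decide_eq_true_eq] at h
  obtain ⟨⟨hhint, hyd⟩, hle⟩ := h
  have hs := (exp_sound_of_hintOk P hhint).1
  have hP : (0 : ℝ) < (2 : ℝ) ^ P := by positivity
  have hydR : (0 : ℝ) < (yd : ℝ) := by exact_mod_cast hyd
  have hleR : (yn : ℝ) * (2 : ℝ) ^ P ≤ ((expLo P N s xn xd : ℕ) : ℝ) * (yd : ℝ) := by exact_mod_cast hle
  rw [div_le_iff₀ hydR]
  nlinarith

/-! ### §2 The `eeb-lin` scalar lemma `e^{s−1} ≤ q` -/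

/-- **Check of the EEB tangent constant**: `exp(sn/sd − 1) ≤ qn/qd` via `expLeCheck` at `x = (sn − sd)/sd`.
[cite: FawziFawziScalet2024, Thm. 3.6] -/
def eebScalarCheck (P N s : ℕ) (sn : ℤ) (sd : ℕ) (qn : ℤ) (qd : ℕ) : Bool :=
  decide (0 < sd) && expLeCheck P N s (sn - sd) sd qn qd

/-- Soundness of `eebScalarCheck`: the reader's hypothesis `Real.exp (s − 1) ≤ q` with `s = sn/sd`, `q = qn/qd`.
[cite: FawziFawziScalet2024, Thm. 3.6] -/
theorem eebScalarCheck_sound {P N s : ℕ} {sn : ℤ} {sd : ℕ} {qn : ℤ} {qd : ℕ}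
    (h : eebScalarCheck P N s sn sd qn qd = true) :
    Real.exp ((sn : ℝ) / sd - 1) ≤ (qn : ℝ) / qd := by
  simp only [eebScalarCheck, Bool.and_eq_true, decide_eq_true_eq] at h
  obtain ⟨hsd, hc⟩ := h
  have hx := expLeCheck_sound hc
  have hsdR : (sd : ℝ) ≠ 0 := by exact_mod_cast hsd.ne'
  have e : (((sn - sd : ℤ)) : ℝ) / sd = (sn : ℝ) / sd - 1 := by
    push_cast
    field_simp
  rwa [e] at hx

/-! ### §3 The `ent` constant `Σ_k e^{−u_k} ≤ 1` -/

/-- Sum of the upper enclosures `expHi(−us_k/ud)` over a list of numerators. [folklore] -/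
def expHiNegSum (P N s : ℕ) (ud : ℕ) : List ℤ → ℕ
  | [] => 0
  | u :: us => expHi P N s (-u) ud + expHiNegSum P N s ud us

/-- All hint checks of a list. [folklore] -/
def expHintAll (N s : ℕ) (ud : ℕ) : List ℤ → Bool
  | [] => true
  | u :: us => expHintOk N s (-u) ud && expHintAll N s ud us

/-- **Check of the ent constant**: every hint in shape and `Σ_k expHi(−us_k/ud) ≤ 2^P`, i.e. `Σ_k e^{−u_k} ≤ 1`
with `u_k = us_k/ud`. [cite: Israel1979, Lemma II.3.1] -/
def entSumCheck (P N s : ℕ) (ud : ℕ) (us : List ℤ) : Bool :=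
  expHintAll N s ud us && decide (expHiNegSum P N s ud us ≤ 2 ^ P)

/-- The list sum of exponentials is below the fixed-point sum of upper enclosures (scaled). [folklore] -/
private theorem sum_exp_le_expHiNegSum (P N s ud : ℕ) :
    ∀ us : List ℤ, expHintAll N s ud us = true →
      (2 : ℝ) ^ P * (us.map fun u : ℤ => Real.exp (-(u : ℝ) / ud)).sum ≤ (expHiNegSum P N s ud us : ℝ)
  | [], _ => by simp [expHiNegSum]
  | u :: us, h => by
      simp only [expHintAll, Bool.and_eq_true] at h
      have h1 := (exp_sound_of_hintOk P h.1).2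
      have h2 := sum_exp_le_expHiNegSum P N s ud us h.2
      simp only [List.map_cons, List.sum_cons, expHiNegSum, Nat.cast_add]
      have e : (((-u : ℤ)) : ℝ) / ud = -(u : ℝ) / ud := by push_cast; ring
      rw [e] at h1
      nlinarith

/-- **Soundness of `entSumCheck`**: `Σ_k exp(−us_k/ud) ≤ 1` (list form). [cite: Israel1979, Lemma II.3.1] -/
theorem entSumCheck_sound {P N s ud : ℕ} {us : List ℤ} (h : entSumCheck P N s ud us = true) :
    (us.map fun u : ℤ => Real.exp (-(u : ℝ) / ud)).sum ≤ 1 := by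
  simp only [entSumCheck, Bool.and_eq_true, decide_eq_true_eq] at h
  have h1 := sum_exp_le_expHiNegSum P N s ud us h.1
  have h2 : (expHiNegSum P N s ud us : ℝ) ≤ (2 : ℝ) ^ P := by exact_mod_cast h.2
  have hP : (0 : ℝ) < (2 : ℝ) ^ P := by positivity
  nlinarith

/-- **Soundness of `entSumCheck`, indexed form**: for `g : Fin n → ℤ` with `entSumCheck` passing on the list
`List.ofFn g`, `Σ_k exp(−g_k/ud) ≤ 1`. [cite: Israel1979, Lemma II.3.1] -/
theorem sum_exp_neg_le_one_of_entSumCheck {P N s ud n : ℕ} {g : Fin n → ℤ}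
    (h : entSumCheck P N s ud (List.ofFn g) = true) :
    ∑ k, Real.exp (-((g k : ℝ) / ud)) ≤ 1 := by
  have h1 := entSumCheck_sound h
  rw [List.map_ofFn, List.sum_ofFn] at h1
  refine le_trans (le_of_eq (Finset.sum_congr rfl fun k _ => ?_)) h1
  simp [neg_div]

/-- **The ent constant from the kernel check.** For an exactly diagonalised witness `G = V diag(g/ud) V⋆`
(`V` unitary, integer numerators `g_k` over a common denominator `ud`) whose list passes `entSumCheck`:
`log Re Tr e^{−G} ≤ 0` — the hypothesis `hc` (with `c = 0`) of the «ent» reader row.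
[cite: Israel1979, Lemma II.3.1] -/
theorem log_re_partitionFn_one_nonpos_of_entSumCheck {ι : Type*} [Fintype ι] [DecidableEq ι]
    {G V : Matrix ι ι ℂ} (hV : V ∈ Matrix.unitaryGroup ι ℂ) {n : ℕ} (e : ι ≃ Fin n) {g : Fin n → ℤ} {ud : ℕ}
    (hG : G = V * diagonal (fun k => (((g (e k) : ℝ) / ud : ℝ) : ℂ)) * star V)
    {P N s : ℕ} (h : entSumCheck P N s ud (List.ofFn g) = true) :
    Real.log (partitionFn 1 G).re ≤ 0 := by
  refine log_re_partitionFn_one_nonpos_of_enclosures hV hG (ep := fun k => Real.exp (-((g (e k) : ℝ) / ud)))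
    (fun k => le_rfl) ?_
  have h1 := sum_exp_neg_le_one_of_entSumCheck h
  calc ∑ k, Real.exp (-((g (e k) : ℝ) / ud)) = ∑ k, Real.exp (-((g k : ℝ) / ud)) :=
        Fintype.sum_equiv e _ _ fun k => rfl
    _ ≤ 1 := h1

/-! ### §4 Kernel smoke tests (`P = 40`, `N = 16`, `s = 4`) -/

/-- `e^{0.3 − 1} = 0.4966 ≤ 1/2` and `e^{1/2 − 1} = 0.6065 ≰ 0.6`. -/
example : eebScalarCheck 40 16 4 3 10 1 2 = true ∧ eebScalarCheck 40 16 4 1 2 6 10 = false := by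
  decide +kernel

/-- The max-entropy single-site witness `u = (log 4, …)` rounded up to `14/10`: `4 e^{−1.4} = 0.986 ≤ 1`. -/
example : entSumCheck 40 16 4 10 [14, 14, 14, 14] = true := by decide +kernel

end Literature.MathematicalPhysics.QuantumLattice

end
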